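import Summits.HubbardSuperconductivity.HubbardSuperconductivity.Theses.ChiralWindow
import Literature.Barriers.HubbardSuperconductivity.PureModelStripeCompetitionProofs
import Literature.MathematicalPhysics.QuantumLattice.DWaveSourceFreePressure
import Summits.HubbardSuperconductivity.HubbardSuperconductivity.Theorems.SsbToEvenTorusLro.Negative.MatrixClausesAndBox
import Summits.HubbardSuperconductivity.HubbardSuperconductivity.Theorems.WcbcsSsbToTorusLRO.Negative.SummitMatrixUniformFloor

/-!
# Crux `CwThesis` (item `stmt-HubbardSuperconductivity-10438`, route ChiralWindow): structure of the target,
# the window's edges, the uniform-floor normal form, and the `U = 0` endpoint modulo the free bound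

Negative-side support file of the standing disprover (generation 1, cycle 1; workfile
`Cruxes/CwThesis/Disproof.lean`). The crux is the route TARGET
`CwThesis : ∃ U₀ > 0, ∀ U ∈ (0,U₀), ∃ δ ∈ [3/10, 12/25], HasDWavePairFieldLROAt U δ` (the summit matrix inlined;
`cwThesis_iff` is `Iff.rfl`). No definition is introduced and no Theses declaration is asserted. Proved:

* §0 `cwThesis_iff` — bridge to the catalogue's matrix, so every tree lemma on `HasDWavePairFieldLROAt` applies.
* §1 armour: `not_cwThesis_iff`, `not_cwThesis_iff_exists_orderPoor` (a disproof = for arbitrarily small `U > 0`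
  and EVERY `δ` of the window, an order-poor admissible ground-state sequence), `cwThesis_iff_eventually` /
  `not_cwThesis_iff_frequently` (`X` is an eventual statement along `𝓝[>] 0`).
* §2 quantifier order: `forallExists_of_existsForall` (a fixed doping in the window suffices) and
  `forallExists_not_imp_existsForall` (abstractly the converse fails: `δ_U` may drift with `U`).
* §3 the three admissibility clauses are load-bearing in thesis shape (`cwThesis_false_without_groundStateClause`,
  `…_without_normalisation`, `…_without_numberClause`, from the tree's `not_matrix_without_*`).
* §4 the window's edges: `hasDWavePairFieldLROAt_of_le_neg_three_halves` (for `δ ≤ -3/2` the matrix is VACUOUSLY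
  TRUE at every `U`: `N_2 ≥ 10 > 8` orbitals of the `2×2` torus), so `cwThesisWithoutWindow_trivial` (the `∃ δ : ℝ`
  variant is trivially provable); `not_hasDWavePairFieldLROAt_of_one_le` (for `δ ≥ 1` the matrix is FALSE at every
  `U`: vacuum sector), so `cwThesisAtEmptyBand_false`.
* §5 `cwThesis_iff_floor` — `X` ↔ a floor `a(U) L⁴` on the pair intensity UNIFORM over the sector's ground space
  at every large even side (tree `hasDWavePairFieldLROAt_iff_floor`).
* §6 `not_hasDWavePairFieldLROAt_zero_of_freeBound`, `cwThesis_false_from_zero_of_freeBound` — modulo the free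
  bound `re⟨ψ, P†P ψ⟩ ≤ C L²` for every normalised sector ground state of the free torus (`L ≥ 3`), the matrix
  fails at `U = 0` for every `δ ≥ 0` and the `U ∈ [0, U₀)` variant of `X` is false (`0 < U` is load-bearing).

Sources: Koma–Tasaki, J. Stat. Phys. 76 (1994) 745 (order parameter, Conjecture 10); Scalapino, Phys. Rep. 250
(1995) 329 §2; Lieb, PRL 62 (1989) 1201 (sectors); Friedli–Velenik 2017 §3.7.2 (LRO as a liminf). Elementary
bookkeeping over the finite-dimensional variational principle.
-/

noncomputable section

namespace Summit.HubbardSuperconductivity.CwThesis.Negative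

open Literature.MathematicalPhysics.QuantumLattice Literature.Barriers.HubbardSuperconductivity
open Literature.Probability.LatticeModels
open Filter Set Matrix
open scoped ComplexOrder
open _root_.Topology
open Summit.HubbardSuperconductivity.HubbardSuperconductivity.Theses.ChiralWindow (CwThesis)
open Summit.HubbardSuperconductivity.HubbardSuperconductivity.Theorems.SsbToEvenTorusLro.Negative
open Summit.HubbardSuperconductivity.WcbcsSsbToTorusLRO.Negative

/-! ### §0 The bridge to the catalogue's matrix -/

/-- `CwThesis` is, by `Iff.rfl`, the weak-coupling window statement over the barrier catalogue's matrix
`HasDWavePairFieldLROAt U δ` (which the route file inlines word for word). [folklore] -/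
theorem cwThesis_iff :
    CwThesis ↔ ∃ U₀ : ℝ, 0 < U₀ ∧ ∀ U ∈ Ioo (0:ℝ) U₀, ∃ δ ∈ Icc (3/10 : ℝ) (12/25),
      HasDWavePairFieldLROAt U δ :=
  Iff.rfl

/-! ### §1 Armour: what a disproof must exhibit -/

/-- **Negation through the quantifiers**: `¬X` iff for every `U₀ > 0` some `U ∈ (0, U₀)` has NO doping in
the window at which the summit matrix holds. [folklore] -/
theorem not_cwThesis_iff :
    ¬ CwThesis ↔ ∀ U₀ : ℝ, 0 < U₀ → ∃ U ∈ Ioo (0:ℝ) U₀, ∀ δ ∈ Icc (3/10 : ℝ) (12/25),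
      ¬ HasDWavePairFieldLROAt U δ := by
  rw [cwThesis_iff]
  push Not
  rfl

/-- **The armour.** A disproof of `CwThesis` exhibits, for arbitrarily small `U > 0` and EVERY `δ` of the
window, an admissible sequence (normalised `(N_L, S^z=0)`-sector ground states of `hubbardTorus 2 L 1 U`,
`N_L = 2⌊(1-δ)L²/2⌋`, at the even sides) WITHOUT `d_{x²-y²}` pair-field long-range order. [folklore] -/
theorem not_cwThesis_iff_exists_orderPoor :
    ¬ CwThesis ↔ ∀ U₀ : ℝ, 0 < U₀ → ∃ U ∈ Ioo (0:ℝ) U₀, ∀ δ ∈ Icc (3/10 : ℝ) (12/25),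
      ∃ (N : ℕ → ℕ) (ψ : ∀ L, Fock (Orb (FermionTorus 2 L))),
        (∀ L, Even L → N L = 2 * ⌊(1 - δ) * (L : ℝ) ^ 2 / 2⌋₊ ∧ star (ψ L) ⬝ᵥ ψ L = 1 ∧
            IsGroundStateInSector (hubbardTorus 2 L 1 U) (N L) 0 (ψ L)) ∧
          ¬ HasLongRangeOrder (fun k => halfOpenBox 2 (2 * k))
              (fun k => torusPullback (pairFieldCorr dWaveFormFactor ψ) (2 * k)) := by
  simp only [not_cwThesis_iff, not_hasDWavePairFieldLROAt_iff]

/-- **`X` is an eventual statement as `U → 0⁺`**: `X ↔ ∀ᶠ U in 𝓝[>] 0, ∃ δ ∈ window, matrix at (U, δ)`.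
In particular `X` is monotone in `U₀` and a refutation must bite FREQUENTLY along `U → 0⁺`. [folklore] -/
theorem cwThesis_iff_eventually :
    CwThesis ↔ ∀ᶠ U in 𝓝[>] (0:ℝ), ∃ δ ∈ Icc (3/10 : ℝ) (12/25), HasDWavePairFieldLROAt U δ := by
  rw [cwThesis_iff]
  constructor
  · rintro ⟨U₀, hU₀, h⟩
    filter_upwards [Ioo_mem_nhdsGT hU₀] with U hU using h U hU
  · intro h
    obtain ⟨U₀, hU₀mem, hU₀⟩ := mem_nhdsGT_iff_exists_Ioo_subset.1 h
    exact ⟨U₀, hU₀mem, fun U hU => hU₀ hU⟩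

/-- Negated eventual form: `¬X ↔ ∃ᶠ U in 𝓝[>] 0, ∀ δ ∈ window, ¬ matrix at (U, δ)`. [folklore] -/
theorem not_cwThesis_iff_frequently :
    ¬ CwThesis ↔ ∃ᶠ U in 𝓝[>] (0:ℝ), ∀ δ ∈ Icc (3/10 : ℝ) (12/25), ¬ HasDWavePairFieldLROAt U δ := by
  rw [cwThesis_iff_eventually, Filter.not_eventually]
  simp only [not_exists, not_and]

/-! ### §2 Quantifier order: `∀ U ∃ δ` versus `∃ δ ∀ U` -/

/-- **A fixed doping suffices** (shapes over the matrix): a statement of the shape of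
`WeakCouplingBCS.WcbcsThesis` but with its doping inside the window (`∃ δ ∈ [3/10,12/25] ∃ U₀ > 0 ∀ U ∈ (0,U₀)`,
matrix) implies the `∀ U ∃ δ` shape of `CwThesis` (its right-hand side under `cwThesis_iff`). The converse is
not formal — see `forallExists_not_imp_existsForall`; and `WcbcsThesis` itself only places `δ` in `(0, 1/2)`.
[folklore] -/
theorem forallExists_of_existsForall
    (h : ∃ δ ∈ Icc (3/10 : ℝ) (12/25), ∃ U₀ : ℝ, 0 < U₀ ∧ ∀ U ∈ Ioo (0:ℝ) U₀,
      HasDWavePairFieldLROAt U δ) :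
    ∃ U₀ : ℝ, 0 < U₀ ∧ ∀ U ∈ Ioo (0:ℝ) U₀, ∃ δ ∈ Icc (3/10 : ℝ) (12/25),
      HasDWavePairFieldLROAt U δ := by
  obtain ⟨δ, hδ, U₀, hU₀, h⟩ := h
  exact ⟨U₀, hU₀, fun U hU => ⟨δ, hδ, h U hU⟩⟩

/-- **Abstract independence of the quantifier order.** For SOME matrix `M U δ` the `∀ U ∃ δ` form holds on
the window while the `∃ δ ∀ U` form fails (witness: `M U δ := δ = 3/10 + U/10`, a doping drifting with the
coupling, as the route's crossing line `δ*(U)` is allowed to). So nothing formal lets a prover of `X` fix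
`δ` first, and nothing formal lets a refuter attack one `δ`. [folklore] -/
theorem forallExists_not_imp_existsForall :
    ∃ M : ℝ → ℝ → Prop,
      (∃ U₀ : ℝ, 0 < U₀ ∧ ∀ U ∈ Ioo (0:ℝ) U₀, ∃ δ ∈ Icc (3/10 : ℝ) (12/25), M U δ) ∧
        ¬ (∃ δ ∈ Icc (3/10 : ℝ) (12/25), ∃ U₀ : ℝ, 0 < U₀ ∧ ∀ U ∈ Ioo (0:ℝ) U₀, M U δ) := by
  refine ⟨fun U δ => δ = 3/10 + U / 10, ⟨1, one_pos, fun U hU => ⟨3/10 + U / 10,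
    ⟨by linarith [hU.1], by linarith [hU.2]⟩, rfl⟩⟩, ?_⟩
  rintro ⟨δ, -, U₀, hU₀, h⟩
  have h1 : δ = 3/10 + U₀ / 2 / 10 := h (U₀ / 2) ⟨by linarith, by linarith⟩
  have h2 : δ = 3/10 + U₀ / 4 / 10 := h (U₀ / 4) ⟨by linarith, by linarith⟩
  linarith

/-! ### §3 The three admissibility clauses are load-bearing in thesis shape -/

/-- **`CwThesisWithoutGroundStateClause` is false**: drop "`ψ_L` is a sector ground state" (keep the number
clause and normalisation) and the thesis fails — the normalised vacuum sequence is admissible and has no pair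
correlations (tree `not_matrix_without_groundStateClause`). [folklore] -/
theorem cwThesis_false_without_groundStateClause :
    ¬ ∃ U₀ : ℝ, 0 < U₀ ∧ ∀ U ∈ Ioo (0:ℝ) U₀, ∃ δ ∈ Icc (3/10 : ℝ) (12/25),
        ∀ (N : ℕ → ℕ) (ψ : ∀ L, Fock (Orb (FermionTorus 2 L))),
          (∀ L, Even L → N L = 2 * ⌊(1 - δ) * (L : ℝ) ^ 2 / 2⌋₊ ∧ star (ψ L) ⬝ᵥ ψ L = 1) →
            HasLongRangeOrder (fun k => halfOpenBox 2 (2 * k))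
              (fun k => torusPullback (pairFieldCorr dWaveFormFactor ψ) (2 * k)) := by
  rintro ⟨U₀, hU₀, h⟩
  obtain ⟨δ, -, hδ⟩ := h (U₀ / 2) ⟨by linarith, by linarith⟩
  exact not_matrix_without_groundStateClause δ hδ

/-- **`CwThesisWithoutNormalisation` is false**: drop `star ψ_L ⬝ᵥ ψ_L = 1` and the thesis fails at every
`U` — rescaled ground states kill the `liminf` (tree `not_matrix_without_normalisation`, `δ ≥ -1`). [folklore] -/
theorem cwThesis_false_without_normalisation :
    ¬ ∃ U₀ : ℝ, 0 < U₀ ∧ ∀ U ∈ Ioo (0:ℝ) U₀, ∃ δ ∈ Icc (3/10 : ℝ) (12/25),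
        ∀ (N : ℕ → ℕ) (ψ : ∀ L, Fock (Orb (FermionTorus 2 L))),
          (∀ L, Even L → N L = 2 * ⌊(1 - δ) * (L : ℝ) ^ 2 / 2⌋₊ ∧
              IsGroundStateInSector (hubbardTorus 2 L 1 U) (N L) 0 (ψ L)) →
            HasLongRangeOrder (fun k => halfOpenBox 2 (2 * k))
              (fun k => torusPullback (pairFieldCorr dWaveFormFactor ψ) (2 * k)) := by
  rintro ⟨U₀, hU₀, h⟩
  obtain ⟨δ, hδ, h'⟩ := h (U₀ / 2) ⟨by linarith, by linarith⟩
  exact not_matrix_without_normalisation (U₀ / 2) (by linarith [hδ.1]) h'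

/-- **`CwThesisWithoutNumberClause` is false**: drop `N_L = 2⌊(1-δ)L²/2⌋` and the thesis fails at every
`U` — the normalised ground states of the empty sector `(0, 0)` are admissible and order-free (tree
`not_matrix_without_numberClause`). [folklore] -/
theorem cwThesis_false_without_numberClause :
    ¬ ∃ U₀ : ℝ, 0 < U₀ ∧ ∀ U ∈ Ioo (0:ℝ) U₀, ∃ _δ ∈ Icc (3/10 : ℝ) (12/25),
        ∀ (N : ℕ → ℕ) (ψ : ∀ L, Fock (Orb (FermionTorus 2 L))),
          (∀ L, Even L → star (ψ L) ⬝ᵥ ψ L = 1 ∧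
              IsGroundStateInSector (hubbardTorus 2 L 1 U) (N L) 0 (ψ L)) →
            HasLongRangeOrder (fun k => halfOpenBox 2 (2 * k))
              (fun k => torusPullback (pairFieldCorr dWaveFormFactor ψ) (2 * k)) := by
  rintro ⟨U₀, hU₀, h⟩
  obtain ⟨_, -, h'⟩ := h (U₀ / 2) ⟨by linarith, by linarith⟩
  exact not_matrix_without_numberClause (U₀ / 2) h'

/-! ### §4 The window's edges: vacuity below `δ = -1`, the empty band above `δ = 1` -/

/-- The number of orbitals of the fermionic `2 × 2` torus is `8`. [folklore] -/
theorem card_orb_fermionTorus_two_two : Fintype.card (Orb (FermionTorus 2 2)) = 8 := by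
  rw [card_orb_fermionTorus_two]; norm_num

/-- **Vacuous truth below the band**: for `δ ≤ -3/2` the matrix `HasDWavePairFieldLROAt U δ` holds at EVERY
`U`, for want of admissible sequences — at the even side `L = 2` the prescribed particle number
`N_2 = 2⌊2(1-δ)⌋ ≥ 10` exceeds the `8` orbitals of the `2 × 2` torus, so the sector `(N_2, 0)` is `⊥` and no
nonzero ground state exists there. [folklore] -/
theorem hasDWavePairFieldLROAt_of_le_neg_three_halves (U : ℝ) {δ : ℝ} (hδ : δ ≤ -3/2) :
    HasDWavePairFieldLROAt U δ := by
  intro N ψ hadm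
  exfalso
  obtain ⟨hN, -, hGS⟩ := hadm 2 even_two
  have hfloor : 5 ≤ ⌊(1 - δ) * ((2:ℕ) : ℝ) ^ 2 / 2⌋₊ := Nat.le_floor (by push_cast; nlinarith)
  have hN10 : 10 ≤ N 2 := by rw [hN]; omega
  have hmem : IsNParticle (N 2) (ψ 2) := ((mem_szSector_iff _ _ _).1 hGS.1).1
  apply hGS.2.1
  funext s
  refine hmem s (fun hs => ?_)
  have hle : s.card ≤ Fintype.card (Orb (FermionTorus 2 2)) := Finset.card_le_univ s
  rw [card_orb_fermionTorus_two_two] at hle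
  omega

/-- **`CwThesisWithoutWindow` is trivially TRUE**: with the doping window replaced by `∃ δ : ℝ` the thesis is
provable by the vacuity above (`δ := -2`). The lower window edge (indeed any edge `> -1`) is what keeps `X`
honest: it is anti-vacuity bookkeeping before it is physics. [folklore] -/
theorem cwThesisWithoutWindow_trivial :
    ∃ U₀ : ℝ, 0 < U₀ ∧ ∀ U ∈ Ioo (0:ℝ) U₀, ∃ δ : ℝ, HasDWavePairFieldLROAt U δ :=
  ⟨1, one_pos, fun U _ => ⟨-2, hasDWavePairFieldLROAt_of_le_neg_three_halves U (by norm_num)⟩⟩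

/-- **The empty band is order-free**: for `δ ≥ 1` the prescribed particle number is `N_L = 0`; the
normalised ground states of the sector `(0, 0)` — multiples of the vacuum, which exist on every torus — form
an admissible sequence with identically vanishing pair correlations, so the matrix FAILS at every `U`.
[folklore] -/
theorem not_hasDWavePairFieldLROAt_of_one_le (U : ℝ) {δ : ℝ} (hδ : 1 ≤ δ) :
    ¬ HasDWavePairFieldLROAt U δ := by
  intro h
  have hN : ∀ L : ℕ, 2 * ⌊(1 - δ) * (L : ℝ) ^ 2 / 2⌋₊ = 2 * 0 := fun L => by
    rw [Nat.floor_of_nonpos]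
    have hL : (0:ℝ) ≤ (L : ℝ) ^ 2 := by positivity
    have : (1 - δ) * (L : ℝ) ^ 2 ≤ 0 := mul_nonpos_of_nonpos_of_nonneg (by linarith) hL
    linarith
  have key : ∀ L : ℕ, ∃ φ : Fock (Orb (FermionTorus 2 L)), star φ ⬝ᵥ φ = 1 ∧
      IsGroundStateInSector (hubbardTorus 2 L 1 U) (2 * 0) 0 φ :=
    fun L => exists_unit_isGroundStateInSector_hubbardTorus U L 0 (Nat.zero_le _)
  choose φ hφ using key
  have hvac : ∀ L, φ L = φ L ∅ • (vacuum : Fock (Orb (FermionTorus 2 L))) := fun L =>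
    eq_smul_vacuum_of_isNParticle_zero ((mem_szSector_iff _ _ _).1 (hφ L).2.1).1
  have hl := h (fun L => 2 * ⌊(1 - δ) * (L : ℝ) ^ 2 / 2⌋₊) φ
    fun L _ => ⟨rfl, (hφ L).1, by rw [hN]; exact (hφ L).2⟩
  have hzero : ∀ (k : ℕ) (x y : TorusSite 2 (2 * k)),
      pairFieldCorr dWaveFormFactor φ (2 * k) x y = 0 := by
    intro k x y
    have e : φ = fun L => (φ L ∅) • (fun _ => (vacuum : Fock (Orb (FermionTorus 2 _)))) L :=
      funext fun L => hvac L
    rw [e, pairFieldCorr_smul, pairFieldCorr_vacuum, mul_zero]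
  unfold HasLongRangeOrder at hl
  simp only [torusPullback_apply, hzero, Finset.sum_const_zero, zero_div, liminf_const] at hl
  exact lt_irrefl _ hl

/-- **`CwThesisAtEmptyBand` is false**: with the window replaced by (any subset of) `[1, ∞)` the thesis
fails. Together with `cwThesisWithoutWindow_trivial`: bookkeeping alone forces a window inside `(-1, 1)`;
`Assembly` needs `⊆ (0, 1/2)`. [folklore] -/
theorem cwThesisAtEmptyBand_false :
    ¬ ∃ U₀ : ℝ, 0 < U₀ ∧ ∀ U ∈ Ioo (0:ℝ) U₀, ∃ δ ∈ Ici (1:ℝ), HasDWavePairFieldLROAt U δ := by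
  rintro ⟨U₀, hU₀, h⟩
  obtain ⟨δ, hδ, hm⟩ := h (U₀ / 2) ⟨by linarith, by linarith⟩
  exact not_hasDWavePairFieldLROAt_of_one_le _ hδ hm

/-! ### §5 Normal form: a floor uniform over the ground space -/

/-- **`X` as a uniform floor.** `CwThesis` holds iff for all small `U > 0` there are a doping `δ_U` in the
window and a constant `a(U) > 0` such that, at every large even side `L = 2k+2`, EVERY normalised ground state
`ψ` of `hubbardTorus 2 L 1 U` in the sector `(2⌊(1-δ_U)L²/2⌋, 0)` has pair intensity
`re⟨ψ, P†P ψ⟩ ≥ a(U)·L⁴` (`P = pairField dWaveFormFactor L = √2 Δ_d`; tree `hasDWavePairFieldLROAt_iff_floor`).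
One order-poor ground state per large even side, at every `δ` of the window, refutes `X` at that `U`. [folklore] -/
theorem cwThesis_iff_floor :
    CwThesis ↔ ∃ U₀ : ℝ, 0 < U₀ ∧ ∀ U ∈ Ioo (0:ℝ) U₀, ∃ δ ∈ Icc (3/10 : ℝ) (12/25),
      ∃ a : ℝ, 0 < a ∧ ∀ᶠ k : ℕ in atTop, ∀ ψ : Fock (Orb (FermionTorus 2 (2 * k + 1 + 1))),
        IsGroundStateInSector (hubbardTorus 2 (2 * k + 1 + 1) 1 U)
            (2 * ⌊(1 - δ) * (((2 * k + 1 + 1 : ℕ) : ℝ)) ^ 2 / 2⌋₊) 0 ψ →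
          star ψ ⬝ᵥ ψ = 1 →
            a * ((2 * k + 1 + 1 : ℕ) : ℝ) ^ 4 ≤
              (expect ((pairField dWaveFormFactor (2 * k + 1 + 1))ᴴ *
                pairField dWaveFormFactor (2 * k + 1 + 1)) ψ).re := by
  rw [cwThesis_iff]
  refine exists_congr fun U₀ => and_congr_right fun _ => forall₂_congr fun U _ =>
    exists_congr fun δ => and_congr_right fun hδ => ?_
  exact hasDWavePairFieldLROAt_iff_floor (by linarith [hδ.1])

/-! ### §6 The `U = 0` endpoint: `0 < U` is load-bearing (modulo the free bound) -/

/-- **No pair order at `U = 0`, given the free bound.** If every normalised sector ground state of the free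
torus (`L ≥ 3`) has pair intensity at most `C·L²`, then the summit matrix FAILS at `U = 0` for every
`δ ≥ 0`: by the floor form a positive floor `a L⁴ ≤ C L²` would hold at every large even side (ground states
exist in every admissible sector), absurd. [folklore] -/
theorem not_hasDWavePairFieldLROAt_zero_of_freeBound {C : ℝ}
    (hfree : ∀ (L : ℕ) [NeZero L], 3 ≤ L → ∀ (n : ℕ) (ψ : Fock (Orb (FermionTorus 2 L))),
      IsGroundStateInSector (hubbardTorus 2 L 1 0) (2 * n) 0 ψ → star ψ ⬝ᵥ ψ = 1 →
        (expect ((pairField dWaveFormFactor L)ᴴ * pairField dWaveFormFactor L) ψ).re ≤ C * (L : ℝ) ^ 2)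
    {δ : ℝ} (hδ : 0 ≤ δ) : ¬ HasDWavePairFieldLROAt 0 δ := by
  intro h
  obtain ⟨a, ha, hev⟩ := floor_of_hasDWavePairFieldLROAt hδ h
  -- eventually `a (2k+2)² ≤ C`, impossible
  obtain ⟨n, hn⟩ := exists_nat_gt (C / a)
  have hev2 : ∀ᶠ k : ℕ in atTop, n ≤ k ∧ 1 ≤ k := by
    filter_upwards [eventually_ge_atTop n, eventually_ge_atTop 1] with k h1 h2 using ⟨h1, h2⟩
  obtain ⟨k, hk, hnk, hk1⟩ := (hev.and hev2).exists
  set L : ℕ := 2 * k + 1 + 1 with hL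
  haveI : NeZero L := ⟨by omega⟩
  have hL3 : 3 ≤ L := by omega
  obtain ⟨ψ, hψ1, hψ⟩ := exists_unit_groundStateInSector L (0:ℝ)
    (halfFilling_floor_le_sq L hδ)
  have hlow := hk ψ hψ hψ1
  have hup := hfree L hL3 _ ψ hψ hψ1
  have hLpos : (0:ℝ) < (L : ℝ) ^ 2 := by positivity
  have hLge : (n : ℝ) + 1 ≤ (L : ℝ) := by
    have : n + 1 ≤ L := by omega
    exact_mod_cast this
  have h4 : ((L : ℕ) : ℝ) ^ 4 = (L : ℝ) ^ 2 * (L : ℝ) ^ 2 := by ring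
  have key : a * (L : ℝ) ^ 2 ≤ C := by
    have := hlow.trans hup
    rw [h4, ← mul_assoc] at this
    exact le_of_mul_le_mul_right this hLpos
  have hCa : C / a < (L : ℝ) ^ 2 := by
    calc C / a < n := hn
      _ ≤ (n : ℝ) + 1 := by linarith
      _ ≤ (L : ℝ) := hLge
      _ ≤ (L : ℝ) ^ 2 := by
          have h1 : (1:ℝ) ≤ (L:ℝ) := by
            have : 1 ≤ L := by omega
            exact_mod_cast this
          nlinarith
  rw [div_lt_iff₀ ha] at hCa
  linarith [mul_comm a ((L:ℝ)^2)]

/-- **`CwThesisFromZero` is false, given the free bound**: the variant of `X` with `U ∈ [0, U₀)` (the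
hypothesis `0 < U` dropped) fails, because at `U = 0` no doping of the window carries the matrix. Any proof
of `X` uses `U > 0` quantitatively; with §5, the floor `a(U, δ_U)` cannot be bounded below uniformly as
`U → 0⁺`. [folklore] -/
theorem cwThesis_false_from_zero_of_freeBound {C : ℝ}
    (hfree : ∀ (L : ℕ) [NeZero L], 3 ≤ L → ∀ (n : ℕ) (ψ : Fock (Orb (FermionTorus 2 L))),
      IsGroundStateInSector (hubbardTorus 2 L 1 0) (2 * n) 0 ψ → star ψ ⬝ᵥ ψ = 1 →
        (expect ((pairField dWaveFormFactor L)ᴴ * pairField dWaveFormFactor L) ψ).re ≤ C * (L : ℝ) ^ 2) :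
    ¬ ∃ U₀ : ℝ, 0 < U₀ ∧ ∀ U ∈ Ico (0:ℝ) U₀, ∃ δ ∈ Icc (3/10 : ℝ) (12/25),
        HasDWavePairFieldLROAt U δ := by
  rintro ⟨U₀, hU₀, h⟩
  obtain ⟨δ, hδ, hm⟩ := h 0 ⟨le_rfl, hU₀⟩
  exact not_hasDWavePairFieldLROAt_zero_of_freeBound hfree (by linarith [hδ.1]) hm

end Summit.HubbardSuperconductivity.CwThesis.Negative

end
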